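import Summits.SmoothPoincare4.SmoothPoincare4.Theses.SymplecticOrigami
import Literature.Topology.FourManifolds.ClosedBallProofs

/-!
# `OrigamiFoldExistence` — negative-side support: zero slack (crux stmt-SmoothPoincare4-7844)

Negative-side bookkeeping from the standing disprover's work file
`Cruxes/OrigamiFoldExistence/Disproof.lean` (§2): the typed fold data of
`OrigamiRung` / `OrigamiFoldExistence` TRANSPORT along a `C^∞` diffeomorphism
(`foldData_transport`), hence

* `origamiFoldExistence_of_smoothPoincare4` : `SmoothPoincare4 → RoundSphereIsOrigamiFold →
  OrigamiFoldExistence` (the converse of the route's assembly modulo the S⁴ instance), and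
* `not_smoothPoincare4_of_not_origamiFoldExistence` : any disproof of the crux is — given the
  route's own support item `RoundSphereIsOrigamiFold` (CdGP Ex. 2.3/2.6) — a disproof of the smooth
  4-dimensional Poincaré conjecture, i.e. an exotic 4-sphere.

Together with the gate-checked assembly `closes : OrigamiRung → NoGenusTwoDoor →
OrigamiFoldExistence → SmoothPoincare4` this pins the crux: modulo (R, D, RS) it is EQUIVALENT to
SPC4 ("zero slack"), so no counterexample search short of an exotic sphere can bite.
-/

noncomputable section

-- the prescribed namespace `Summit.<P>.<Sub>.…` duplicates `SmoothPoincare4` (P = Sub)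
set_option linter.dupNamespace false

open scoped Manifold ContDiff Topology ContinuousMap
open Set Function

namespace Summit.SmoothPoincare4.SmoothPoincare4.Theorems.OrigamiFoldExistence.Negative

open Summit.SmoothPoincare4.SmoothPoincare4.Theses.SymplecticOrigami

/-- Precomposing with a linear isomorphism does not change the dimension of the kernel.
[folklore] -/
theorem finrank_ker_comp_equiv {E₁ E₂ F : Type*} [TopologicalSpace E₁] [AddCommGroup E₁]
    [Module ℝ E₁] [TopologicalSpace E₂] [AddCommGroup E₂] [Module ℝ E₂] [TopologicalSpace F]
    [AddCommGroup F] [Module ℝ F] (A : E₂ →L[ℝ] F) (L : E₁ ≃L[ℝ] E₂) :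
    Module.finrank ℝ (LinearMap.ker ((A.comp (L : E₁ →L[ℝ] E₂)).toLinearMap)) =
      Module.finrank ℝ (LinearMap.ker A.toLinearMap) := by
  have hc : (A.comp (L : E₁ →L[ℝ] E₂)).toLinearMap =
      A.toLinearMap.comp (L : E₁ →L[ℝ] E₂).toLinearMap := rfl
  rw [hc, LinearMap.ker_comp]
  exact (L.toLinearEquiv.ofSubmodule' (LinearMap.ker A.toLinearMap)).finrank_eq

/-- **Transport of the typed fold data along a diffeomorphism.** If `Φ : M ≃ₘ M'` is a `C^∞`
diffeomorphism and `M'` carries the fold data of `OrigamiRung` (disjoint nonempty open `V 0, V 1`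
with connected complement an embedded 3-manifold, closed symplectic pieces `(N i, s i)` with
symplectic surfaces `b i` and blow-down maps `β i`), then so does `M`: pull back `V i ↦ Φ⁻¹(V i)`,
keep `(N i, s i, S i, b i)`, replace `β i ↦ β i ∘ Φ` and `z ↦ Φ.symm ∘ z`. [folklore] -/
theorem foldData_transport {M : Type} [TopologicalSpace M]
    [ChartedSpace (EuclideanSpace ℝ (Fin 4)) M] [IsManifold (𝓡 4) ∞ M]
    {M' : Type} [TopologicalSpace M'] [ChartedSpace (EuclideanSpace ℝ (Fin 4)) M']
    [IsManifold (𝓡 4) ∞ M'] (Φ : M ≃ₘ⟮𝓡 4, 𝓡 4⟯ M')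
    (h : ∃ (V : Fin 2 → TopologicalSpace.Opens M') (N : Fin 2 → Type) (_ : ∀ i, TopologicalSpace (N i)) (_ : ∀ i, T2Space (N i)) (_ : ∀ i, SecondCountableTopology (N i)) (_ : ∀ i, CompactSpace (N i)) (_ : ∀ i, ConnectedSpace (N i)) (_ : ∀ i, ChartedSpace (EuclideanSpace ℝ (Fin 4)) (N i)) (_ : ∀ i, IsManifold (𝓡 4) ∞ (N i)) (s : ∀ i, Literature.Geometry.Kaehler.MForm (𝓡 4) (N i) ℝ 2) (S : Fin 2 → Type) (_ : ∀ i, TopologicalSpace (S i)) (_ : ∀ i, CompactSpace (S i)) (_ : ∀ i, ConnectedSpace (S i)) (_ : ∀ i, ChartedSpace (EuclideanSpace ℝ (Fin 2)) (S i)) (_ : ∀ i, IsManifold (𝓡 2) ∞ (S i)) (b : ∀ i, S i → N i) (β : ∀ i, M' → N i), (Disjoint (V 0) (V 1) ∧ (∀ i, (V i : Set M').Nonempty) ∧ IsConnected ((V 0 : Set M') ∪ (V 1 : Set M'))ᶜ ∧ (∃ (Z : Type) (_ : TopologicalSpace Z) (_ : ChartedSpace (EuclideanSpace ℝ (Fin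 3)) Z) (_ : IsManifold (𝓡 3) ∞ Z) (z : Z → M'), Manifold.IsSmoothEmbedding (𝓡 3) (𝓡 4) ∞ z ∧ Set.range z = ((V 0 : Set M') ∪ (V 1 : Set M'))ᶜ)) ∧ (∀ i, Literature.Geometry.Kaehler.IsSmoothForm (s i) ∧ Literature.Geometry.Kaehler.IsClosedForm (s i) ∧ (∀ x (v : TangentSpace (𝓡 4) x), v ≠ 0 → ∃ w, s i x ![v, w] ≠ 0) ∧ Manifold.IsSmoothEmbedding (𝓡 2) (𝓡 4) ∞ (b i) ∧ (∀ y (v : TangentSpace (𝓡 2) y), v ≠ 0 → ∃ w : TangentSpace (𝓡 2) y, s i (b i y) ![mfderiv (𝓡 2) (𝓡 4) (b i) y v, mfderiv (𝓡 2) (𝓡 4) (b i) y w] ≠ 0) ∧ (∃ U : Set M', IsOpen U ∧ closure (V i : Set M') ⊆ U ∧ ContMDiffOn (𝓡 4) (𝓡 4) ∞ (β i) U) ∧ Set.InjOn (β i) (V i : Set M') ∧ β i '' (V i : Set M') = (Set.range (b i))ᶜ ∧ (∀ x ∈ (V i : Set M'), Function.Bijective (mfderiv (𝓡 4) (𝓡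 4) (β i) x)) ∧ β i '' frontier (V i : Set M') ⊆ Set.range (b i) ∧ (∀ x ∈ frontier (V i : Set M'), Module.finrank ℝ (LinearMap.ker (mfderiv (𝓡 4) (𝓡 4) (β i) x).toLinearMap) = 1))) :
    ∃ (V : Fin 2 → TopologicalSpace.Opens M) (N : Fin 2 → Type) (_ : ∀ i, TopologicalSpace (N i)) (_ : ∀ i, T2Space (N i)) (_ : ∀ i, SecondCountableTopology (N i)) (_ : ∀ i, CompactSpace (N i)) (_ : ∀ i, ConnectedSpace (N i)) (_ : ∀ i, ChartedSpace (EuclideanSpace ℝ (Fin 4)) (N i)) (_ : ∀ i, IsManifold (𝓡 4) ∞ (N i)) (s : ∀ i, Literature.Geometry.Kaehler.MForm (𝓡 4) (N i) ℝ 2) (S : Fin 2 → Type) (_ : ∀ i, TopologicalSpace (S i)) (_ : ∀ i, CompactSpace (S i)) (_ : ∀ i, ConnectedSpace (S i)) (_ : ∀ i, ChartedSpace (EuclideanSpace ℝ (Fin 2)) (S i)) (_ : ∀ i, IsManifold (𝓡 2) ∞ (S i)) (b : ∀ i, S i → N i) (β : ∀ i, M → N i), (Disjoint (V 0) (V 1)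 ∧ (∀ i, (V i : Set M).Nonempty) ∧ IsConnected ((V 0 : Set M) ∪ (V 1 : Set M))ᶜ ∧ (∃ (Z : Type) (_ : TopologicalSpace Z) (_ : ChartedSpace (EuclideanSpace ℝ (Fin 3)) Z) (_ : IsManifold (𝓡 3) ∞ Z) (z : Z → M), Manifold.IsSmoothEmbedding (𝓡 3) (𝓡 4) ∞ z ∧ Set.range z = ((V 0 : Set M) ∪ (V 1 : Set M))ᶜ)) ∧ (∀ i, Literature.Geometry.Kaehler.IsSmoothForm (s i) ∧ Literature.Geometry.Kaehler.IsClosedForm (s i) ∧ (∀ x (v : TangentSpace (𝓡 4) x), v ≠ 0 → ∃ w, s i x ![v, w] ≠ 0) ∧ Manifold.IsSmoothEmbedding (𝓡 2) (𝓡 4) ∞ (b i) ∧ (∀ y (v : TangentSpace (𝓡 2) y), v ≠ 0 → ∃ w : TangentSpace (𝓡 2) y, s i (b i y) ![mfderiv (𝓡 2) (𝓡 4) (b i) y v, mfderiv (𝓡 2) (𝓡 4) (b i) y w] ≠ 0) ∧ (∃ U : Set M, IsOpen U ∧ closure (V i : Set M) ⊆ U ∧ ContMDiffOn (𝓡 4)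 (𝓡 4) ∞ (β i) U) ∧ Set.InjOn (β i) (V i : Set M) ∧ β i '' (V i : Set M) = (Set.range (b i))ᶜ ∧ (∀ x ∈ (V i : Set M), Function.Bijective (mfderiv (𝓡 4) (𝓡 4) (β i) x)) ∧ β i '' frontier (V i : Set M) ⊆ Set.range (b i) ∧ (∀ x ∈ frontier (V i : Set M), Module.finrank ℝ (LinearMap.ker (mfderiv (𝓡 4) (𝓡 4) (β i) x).toLinearMap) = 1)) := by
  obtain ⟨V, N, i1, i2, i3, i4, i5, i6, i7, s, S, j1, j2, j3, j4, j5, b, β, ⟨hdisj, hne, hconn, hZ⟩, hB⟩ :=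
    h
  have hn : (∞ : WithTop ℕ∞) ≠ 0 := by simp
  have hΦi : Injective Φ := EquivLike.injective Φ
  have hΦs : Surjective Φ := EquivLike.surjective Φ
  -- the pulled-back open pieces
  have hWo : ∀ i, IsOpen (Φ ⁻¹' (V i : Set M')) := fun i => (V i).isOpen.preimage Φ.continuous
  refine ⟨fun i => ⟨Φ ⁻¹' (V i : Set M'), hWo i⟩, N, i1, i2, i3, i4, i5, i6, i7, s, S, j1, j2, j3,
    j4, j5, b, fun i => β i ∘ Φ, ⟨?_, ?_, ?_, ?_⟩, ?_⟩
  · -- disjointness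
    rw [← TopologicalSpace.Opens.coe_disjoint] at hdisj ⊢
    exact hdisj.preimage Φ
  · -- non-emptiness
    exact fun i => (hne i).preimage hΦs
  · -- the fold is connected
    show IsConnected (Φ ⁻¹' (V 0 : Set M') ∪ Φ ⁻¹' (V 1 : Set M'))ᶜ
    rw [← Set.preimage_union, ← Set.preimage_compl]
    exact hconn.preimage_of_isOpenMap hΦi Φ.toHomeomorph.isOpenMap
      (by rw [hΦs.range_eq]; exact Set.subset_univ _)
  · -- the fold is an embedded 3-manifold
    obtain ⟨Z, tZ, cZ, mZ, z, hz, hzr⟩ := hZ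
    letI := tZ
    letI := cZ
    haveI := mZ
    refine ⟨Z, tZ, cZ, mZ, Φ.symm ∘ z, hz.diffeomorph_comp Φ.symm, ?_⟩
    show Set.range (Φ.symm ∘ z) = (Φ ⁻¹' (V 0 : Set M') ∪ Φ ⁻¹' (V 1 : Set M'))ᶜ
    rw [Set.range_comp, hzr, Diffeomorph.symm_image_eq_preimage, ← Set.preimage_union,
      ← Set.preimage_compl]
  · -- the piecewise data
    intro i
    obtain ⟨hsm, hcl, hnd, hb, hbs, ⟨U, hUo, hclU, hβU⟩, hinj, himg, hbij, hfr, hker⟩ := hB i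
    have hβdiff : ∀ x, Φ x ∈ closure (V i : Set M') →
        MDifferentiableAt (𝓡 4) (𝓡 4) (β i) (Φ x) := fun x hx =>
      (hβU.contMDiffAt (hUo.mem_nhds (hclU hx))).mdifferentiableAt hn
    have hcomp : ∀ x, Φ x ∈ closure (V i : Set M') →
        mfderiv (𝓡 4) (𝓡 4) (β i ∘ Φ) x =
          (mfderiv (𝓡 4) (𝓡 4) (β i) (Φ x)).comp (mfderiv (𝓡 4) (𝓡 4) Φ x) := fun x hx =>
      mfderiv_comp x (hβdiff x hx) (Φ.mdifferentiable hn x)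
    have hclo : closure (Φ ⁻¹' (V i : Set M')) = Φ ⁻¹' closure (V i : Set M') := by
      have h := Φ.toHomeomorph.preimage_closure (V i : Set M')
      rw [Diffeomorph.coe_toHomeomorph] at h
      exact h.symm
    have hfro : frontier (Φ ⁻¹' (V i : Set M')) = Φ ⁻¹' frontier (V i : Set M') := by
      have h := Φ.toHomeomorph.preimage_frontier (V i : Set M')
      rw [Diffeomorph.coe_toHomeomorph] at h
      exact h.symm
    refine ⟨hsm, hcl, hnd, hb, hbs, ⟨Φ ⁻¹' U, hUo.preimage Φ.continuous, ?_, ?_⟩, ?_, ?_, ?_, ?_, ?_⟩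
    · show closure (Φ ⁻¹' (V i : Set M')) ⊆ Φ ⁻¹' U
      rw [hclo]
      exact Set.preimage_mono hclU
    · exact hβU.comp Φ.contMDiff.contMDiffOn (fun x hx => hx)
    · show Set.InjOn (β i ∘ Φ) (Φ ⁻¹' (V i : Set M'))
      exact hinj.comp hΦi.injOn (Set.mapsTo_preimage Φ _)
    · show (β i ∘ Φ) '' (Φ ⁻¹' (V i : Set M')) = (Set.range (b i))ᶜ
      rw [Set.image_comp, Set.image_preimage_eq _ hΦs]
      exact himg
    · show ∀ x ∈ Φ ⁻¹' (V i : Set M'), Function.Bijective (mfderiv (𝓡 4) (𝓡 4) (β i ∘ Φ) x)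
      intro x hx
      rw [hcomp x (subset_closure hx)]
      exact (hbij (Φ x) hx).comp (Φ.mfderivToContinuousLinearEquiv hn x).bijective
    · show (β i ∘ Φ) '' frontier (Φ ⁻¹' (V i : Set M')) ⊆ Set.range (b i)
      rw [hfro, Set.image_comp, Set.image_preimage_eq _ hΦs]
      exact hfr
    · show ∀ x ∈ frontier (Φ ⁻¹' (V i : Set M')),
        Module.finrank ℝ (LinearMap.ker (mfderiv (𝓡 4) (𝓡 4) (β i ∘ Φ) x).toLinearMap) = 1
      intro x hx
      rw [hfro] at hx
      rw [hcomp x (frontier_subset_closure hx)]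
      have h2 := finrank_ker_comp_equiv (mfderiv (𝓡 4) (𝓡 4) (β i) (Φ x))
        (Φ.mfderivToContinuousLinearEquiv hn x)
      exact h2.trans (hker (Φ x) hx)

/-- **SPC4 and the round-sphere fold give the crux.** If every smooth homotopy 4-sphere is
diffeomorphic to `S⁴` and the round `S⁴` carries the typed fold data (route support item
`RoundSphereIsOrigamiFold`, CdGP Ex. 2.3/2.6), then every smooth homotopy 4-sphere carries the
fold data, by transport. [folklore] -/
theorem origamiFoldExistence_of_smoothPoincare4 (hS : _root_.SmoothPoincare4)
    (hR : RoundSphereIsOrigamiFold) : OrigamiFoldExistence := by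
  intro M _ _ _ _ _ hM
  have hS' := hS
  unfold _root_.SmoothPoincare4 Literature.SPC4.SmoothPoincareConjectureFour
    ContinuousMap.HomotopyEquiv.NonemptyDiffeomorphSphere at hS'
  obtain ⟨Φ⟩ := hS' M inferInstance inferInstance hM
  exact foldData_transport Φ hR

/-- **Zero slack of the crux, negative form.** Given the round-sphere fold
(`RoundSphereIsOrigamiFold`), a refutation of `OrigamiFoldExistence` refutes the smooth
4-dimensional Poincaré conjecture: the non-foldable homotopy 4-sphere is exotic. So the only
counterexamples to the crux are exotic 4-spheres. [folklore] -/
theorem not_smoothPoincare4_of_not_origamiFoldExistence (hR : RoundSphereIsOrigamiFold)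
    (hE : ¬ OrigamiFoldExistence) : ¬ _root_.SmoothPoincare4 :=
  fun hS => hE (origamiFoldExistence_of_smoothPoincare4 hS hR)

end Summit.SmoothPoincare4.SmoothPoincare4.Theorems.OrigamiFoldExistence.Negative

end
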